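/-
Copyright (c) 2026. All rights reserved.
Released under Apache 2.0 license as described in the file LICENSE.
-/
import Literature.Geometry.Kaehler.ComplexTorusQuaternionXSixSpecialCyclesNormaliserClassCount
import Literature.Geometry.Kaehler.ComplexTorusQuaternionXSixEllipticPoints
import Literature.Geometry.Kaehler.ComplexTorusQuaternionCMPointsNotReal
import Literature.Geometry.Kaehler.ComplexTorusQuaternionHeckeIsogenies
import Literature.Geometry.Kaehler.ComplexTorusQuaternionHeckeCMPoints
import HarnessLib

/-!
# The Atkin–Lehner involutions MOVE every point of `Z(t)` on `X₆`, `t ≡ 19 (mod 24)`: for `z_x` fixed by a special vector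
# `x̂ ∈ L(t)` and `W ∈ {w₂, μ, w₆}`, the point `ρ(W)z_x` is not `Γ₆`-equivalent to `z_x`

[tag: complex_torus] [tag: abelian_surface] [tag: quaternion_multiplication] [tag: complex_multiplication]
[tag: shimura_curve] [tag: special_cycles] [tag: atkin_lehner]

`B = (−1,3)_ℚ`, `O₆ ∋ w₂ = 1 + i, μ = 3 + j + ij, w₆ = w₂μ = 3 + 3i + 2ij` (norms `2, 3, 6`, all POSITIVE, so `ρ(W)` acts on
`ℌ` through `ρ = rho (−1) 3 ∘ castQ` and `moebius`), `Γ₆ = O₆¹`. On special VECTORS the Atkin–Lehner group acts without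
fixed classes when both types are defined (`…XSixSpecialCyclesTypes`, `…NormaliserClassCount` §2). This file proves
the statement for POINTS of `X₆ = Γ₆∖ℌ`, where the sign `x̂ ↦ −x̂` is invisible (`z_{−x} = z_x`) and must be absorbed:

* `atkinLehnerTwo_moves_specialPoints` (§2): for `t > 0`, `t ≡ 3 (mod 4)`, `x ∈ L(t)`, `τ ∈ ℌ` with `ρ(x̂)τ = τ`, and
  every `v ∈ Γ₆`: **`ρ(v)(ρ(w₂)τ) ≠ τ`** — `ω₂` fixes no point of `Z(t)` on `X₆`.
* `atkinLehnerThree_moves_specialPoints` (§2): the same for `μ`, under `3 ∤ t`.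
* `atkinLehnerSix_moves_specialPoints` (§2): the same for `w₆`, under `3 ∤ t` (or odd coordinates).

Mechanism (§1, `exists_unit_conj_of_atkinLehner_fixes`): if `ρ(vW)` fixes `z_x`, then `Y = (vW)x̂(vW)‾` is a trace-zero
element fixing `z_x`, hence `Y = s·x̂` with `s² = nr(vW)²` (`conj_eq_smul_of_moebius_eq` with `u = 1`), i.e.
`(vW)x̂ = ±x̂(vW)`; moving `v` across the normalising `W` (`vW = Wa`, `a ∈ Γ₆`) gives `ā·Ad(W⁻¹)x̂ = (±x̂)·ā`, which the
type / norm-sign lemmas `atkinLehner{Two,Three,Six}_not_conj_self_or_neg` forbid. So on the points of `Z(t)` on `X₆`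
(`#= |L(t)/O₆^×|`, `…XSixSpecialCyclesPointCount`) the group `W ≅ (ℤ/2ℤ)²` acts freely for `t ≡ 19 (mod 24)`:
they fall into `|L(t)/O₆^×|/4 = |L(t)/N(O₆)|` orbits of size four — the points of `Z(t)` on `X₆⁺ = X₆/W`.

## The print

* S. Kudla, M. Rapoport, T. Yang (2006), §3.4 Remark 3.4.7 («the group of Atkin-Lehner involutions permutes the
  components transitively … we consider only cycles which are invariant under the group of Atkin-Lehner involutions»),
  (3.4.9)–(3.4.13). [cite: KudlaRapoportYang2006, §3.4 Remark 3.4.7]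
* A. P. Ogg (1983), §2 p. 284 (the fixed points of `w(m)` on a Shimura curve are CM points with `μ² = −m`, or
  `ε = 1 + ζ₄` (`m = 2`), `ε = 1 − ζ₃` (`m = 3`)) — consistent: a `Z(t)`-point with `t ≡ 19 (mod 24)` is none of these.
  [cite: Ogg1983RealPoints, §2]
* P. Bayer, A. Travesa (2007), §2 («`Γ₆⁺/Γ₆ ≅ (ℤ/2ℤ)²`»). [cite: BayerTravesa2007, §2]

## Scope (honest)

Theorems only — no definitions, no named facts, no instances. Pointwise statements on `ℌ`; the quotient
`X₆⁺ = X₆/W` and the orbit count are the interpretation, not formalised here.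
-/

noncomputable section

set_option maxSynthPendingDepth 3

open Quaternion Function

namespace Literature.Geometry.Kaehler.ComplexTorus.QuaternionType

/-! ## §0 Helpers -/

section Helpers

/-- `ρ(1)` acts trivially. [folklore] -/
private theorem moebius_rho_castQ_one₃ (τ : ℂ) :
    moebius (rho (-1) 3 (by norm_num) (castQ (-1) 3 (1 : ℍ[ℚ,((-1 : ℤ) : ℚ),((3 : ℤ) : ℚ)]))) τ = τ := by
  rw [castQ_one, map_one, moebius_apply]
  simp

/-- `ρ(wv) = ρ(w) ∘ ρ(v)` on `ℌ` for positive norms. [folklore] -/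
private theorem moebius_rho_castQ_mul₃ {v w : ℍ[ℚ,((-1 : ℤ) : ℚ),((3 : ℤ) : ℚ)]} (hv : 0 < (v * star v).re)
    (hw : 0 < (w * star w).re) {τ : ℂ} (hτ : 0 < τ.im) :
    moebius (rho (-1) 3 (by norm_num) (castQ (-1) 3 (w * v))) τ =
      moebius (rho (-1) 3 (by norm_num) (castQ (-1) 3 w)) (moebius (rho (-1) 3 (by norm_num) (castQ (-1) 3 v)) τ) := by
  rw [castQ_mul, map_mul]
  exact moebius_mul_of_det_pos (det_rho_castQ_pos _ hw) (det_rho_castQ_pos _ hv) (UpperHalfPlane.mk τ hτ)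

end Helpers

/-! ## §1 The engine: `ρ(vW)` fixing `z_x` forces `ā·Ad(W⁻¹)x̂ = ±x̂·ā` with `a ∈ Γ₆` -/

section Engine

/-- **If `ρ(v)ρ(W)` fixes the point `z_x` of the special vector `x̂` (`v ∈ Γ₆`, `W` a normalising unit of positive norm
with `ẑW = W·F(z)` on special vectors), then some `u ∈ Γ₆` conjugates `F(x) = Ad(W⁻¹)x̂` to `x̂` or to `−x̂`.**
(`Y = (vW)x̂(vW)‾` fixes `z_x`, so `Y = ±nr(vW)·x̂` by `conj_eq_smul_of_moebius_eq`; then move `v` across `W`.)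
[cite: KudlaRapoportYang2006, §3.4 (3.4.9)–(3.4.11) and Remark 3.4.7] -/
theorem exists_unit_conj_of_atkinLehner_fixes {t : ℤ} (ht : 0 < t) {W : ℍ[ℚ,((-1 : ℤ) : ℚ),((3 : ℤ) : ℚ)]} {n : ℚ}
    (hWn : (W * star W).re = n) (hn : 0 < n) (hWu : IsUnit W)
    (hRt : (∀ b : ℍ[ℚ,((-1 : ℤ) : ℚ),((3 : ℤ) : ℚ)], (b ∈ order (-1) 3 ∨ b - ⟨1/2, 1/2, 1/2, -1/2⟩ ∈ order (-1) 3) →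
      ∃ a : ℍ[ℚ,((-1 : ℤ) : ℚ),((3 : ℤ) : ℚ)], (a ∈ order (-1) 3 ∨ a - ⟨1/2, 1/2, 1/2, -1/2⟩ ∈ order (-1) 3) ∧ b * W = W * a))
    {F : {x : ℤ × ℤ × ℤ // x.1 ^ 2 - 3 * x.2.1 ^ 2 - 3 * x.2.2 ^ 2 = t} → ℍ[ℚ,((-1 : ℤ) : ℚ),((3 : ℤ) : ℚ)]}
    (hid : ∀ z : {x : ℤ × ℤ × ℤ // x.1 ^ 2 - 3 * x.2.1 ^ 2 - 3 * x.2.2 ^ 2 = t},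
      (⟨0, z.1.1, z.1.2.1, z.1.2.2⟩ : ℍ[ℚ,((-1 : ℤ) : ℚ),((3 : ℤ) : ℚ)]) * W = W * F z)
    (x : {x : ℤ × ℤ × ℤ // x.1 ^ 2 - 3 * x.2.1 ^ 2 - 3 * x.2.2 ^ 2 = t}) {τ : ℂ} (hτ : 0 < τ.im)
    (hx : moebius (rho (-1) 3 (by norm_num) (castQ (-1) 3 (⟨0, x.1.1, x.1.2.1, x.1.2.2⟩ : ℍ[ℚ,((-1 : ℤ) : ℚ),((3 : ℤ) : ℚ)]))) τ = τ)
    {v : ℍ[ℚ,((-1 : ℤ) : ℚ),((3 : ℤ) : ℚ)]} (hv : v ∈ order (-1) 3 ∨ v - ⟨1/2, 1/2, 1/2, -1/2⟩ ∈ order (-1) 3) (hv1 : v * star v = 1)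
    (h : moebius (rho (-1) 3 (by norm_num) (castQ (-1) 3 v))
      (moebius (rho (-1) 3 (by norm_num) (castQ (-1) 3 W)) τ) = τ) :
    ∃ u : ℍ[ℚ,((-1 : ℤ) : ℚ),((3 : ℤ) : ℚ)], (u ∈ order (-1) 3 ∨ u - ⟨1/2, 1/2, 1/2, -1/2⟩ ∈ order (-1) 3) ∧ (u * star u).re = 1 ∧
      (u * F x = ⟨0, x.1.1, x.1.2.1, x.1.2.2⟩ * u ∨ u * F x = (-⟨0, x.1.1, x.1.2.1, x.1.2.2⟩) * u) := by
  have h3 : (0 : ℤ) < 3 := by norm_num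
  have hxn : ((⟨0, x.1.1, x.1.2.1, x.1.2.2⟩ : ℍ[ℚ,((-1 : ℤ) : ℚ),((3 : ℤ) : ℚ)]) * star ⟨0, x.1.1, x.1.2.1, x.1.2.2⟩).re = t := by
    have hq : x.1.1 ^ 2 - 3 * x.1.2.1 ^ 2 - 3 * x.1.2.2 ^ 2 = t := x.2
    rw [pureVec_norm]; exact_mod_cast hq
  have hxpos : 0 < ((⟨0, x.1.1, x.1.2.1, x.1.2.2⟩ : ℍ[ℚ,((-1 : ℤ) : ℚ),((3 : ℤ) : ℚ)]) * star ⟨0, x.1.1, x.1.2.1, x.1.2.2⟩).re := by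
    rw [hxn]; exact_mod_cast ht
  have hvn : (v * star v).re = 1 := by rw [hv1, QuaternionAlgebra.re_one]
  have hWpos : 0 < (W * star W).re := by rw [hWn]; exact hn
  -- `h := vW` fixes `τ`
  have hhn : (v * W * star (v * W)).re = n := by rw [re_mul_mul_star_mul, hvn, one_mul, hWn]
  have h1 : moebius (rho (-1) 3 (by norm_num) (castQ (-1) 3 (v * W))) τ = τ := by
    rw [moebius_rho_castQ_mul₃ hWpos (by rw [hvn]; exact one_pos) hτ]; exact h
  -- `Y = (vW) x̂ (vW)‾` fixes `τ` too
  have hY := moebius_conj_fixed_of_im_ne_zero h3 (ε := v * W) (x := ⟨0, x.1.1, x.1.2.1, x.1.2.2⟩)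
    (by rw [hhn]; exact hn.ne') hτ.ne' hx
  rw [h1] at hY
  -- hence `Y = s • x̂` with `s² = n²`
  have hYre : (v * W * ⟨0, x.1.1, x.1.2.1, x.1.2.2⟩ * star (v * W)).re = 0 := by
    rw [re_conj_eq]; exact mul_eq_zero_of_right _ rfl
  have hYn : 0 < (v * W * ⟨0, x.1.1, x.1.2.1, x.1.2.2⟩ * star (v * W) *
      star (v * W * ⟨0, x.1.1, x.1.2.1, x.1.2.2⟩ * star (v * W))).re := by
    rw [norm_conj_eq, hhn]; exact mul_pos (pow_pos hn 2) hxpos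
  have hxre : (⟨0, x.1.1, x.1.2.1, x.1.2.2⟩ : ℍ[ℚ,((-1 : ℤ) : ℚ),((3 : ℤ) : ℚ)]).re = 0 := rfl
  have hone : (1 : ℍ[ℚ,((-1 : ℤ) : ℚ),((3 : ℤ) : ℚ)]) * star 1 = 1 := by rw [star_one, mul_one]
  obtain ⟨s, hs, hs2⟩ :=
    conj_eq_smul_of_moebius_eq hone hYre hYn hxre hxpos hτ.ne' hτ.ne' hY hx (moebius_rho_castQ_one₃ τ)
  rw [star_one, mul_one, one_mul] at hs
  rw [norm_conj_eq, hhn] at hs2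
  have hs' : s = n ∨ s = -n := by
    have hsq : s ^ 2 = n ^ 2 := mul_right_cancel₀ hxpos.ne' hs2
    have : (s - n) * (s + n) = 0 := by ring_nf; linarith [hsq]
    rcases mul_eq_zero.1 this with h0 | h0
    · exact Or.inl (by linarith)
    · exact Or.inr (by linarith)
  -- `(vW) x̂ · n = s • x̂ (vW)`, i.e. `(vW)x̂ = ±x̂(vW)`
  have hstar : star (v * W) * (v * W) = ((n : ℚ) : ℍ[ℚ,((-1 : ℤ) : ℚ),((3 : ℤ) : ℚ)]) := by
    rw [star_comm_self', QuaternionAlgebra.mul_star_eq_coe, hhn]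
  have e1 : n • (v * W * ⟨0, x.1.1, x.1.2.1, x.1.2.2⟩) = s • ((⟨0, x.1.1, x.1.2.1, x.1.2.2⟩ : ℍ[ℚ,((-1 : ℤ) : ℚ),((3 : ℤ) : ℚ)]) * (v * W)) := by
    calc n • (v * W * ⟨0, x.1.1, x.1.2.1, x.1.2.2⟩)
        = v * W * ⟨0, x.1.1, x.1.2.1, x.1.2.2⟩ * ((n : ℚ) : ℍ[ℚ,((-1 : ℤ) : ℚ),((3 : ℤ) : ℚ)]) := by
          rw [QuaternionAlgebra.mul_coe_eq_smul]
      _ = (v * W * ⟨0, x.1.1, x.1.2.1, x.1.2.2⟩ * star (v * W)) * (v * W) := by rw [← hstar]; simp only [mul_assoc]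
      _ = s • ((⟨0, x.1.1, x.1.2.1, x.1.2.2⟩ : ℍ[ℚ,((-1 : ℤ) : ℚ),((3 : ℤ) : ℚ)]) * (v * W)) := by rw [hs, smul_mul_assoc]
  have hc : v * W * ⟨0, x.1.1, x.1.2.1, x.1.2.2⟩ = ⟨0, x.1.1, x.1.2.1, x.1.2.2⟩ * (v * W) ∨
      v * W * ⟨0, x.1.1, x.1.2.1, x.1.2.2⟩ = (-⟨0, x.1.1, x.1.2.1, x.1.2.2⟩) * (v * W) := by
    rcases hs' with rfl | rfl
    · exact Or.inl (smul_right_injective _ hn.ne' e1)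
    · right
      rw [neg_smul, ← smul_neg, ← neg_mul] at e1
      exact smul_right_injective _ hn.ne' e1
  -- move `v` across `W`: `vW = Wa`, `a ∈ Γ₆`
  obtain ⟨a, ha, e⟩ := hRt v hv
  have hna : (a * star a).re = 1 := by
    have e2 := re_mul_mul_star_mul v W
    have e3 := re_mul_mul_star_mul W a
    rw [e] at e2
    rw [e2, hvn, one_mul] at e3
    -- `e3 : (W W̄).re = (W W̄).re * (a ā).re`
    have : (W * star W).re * (a * star a).re = (W * star W).re * 1 := by rw [mul_one]; exact e3.symm
    exact mul_left_cancel₀ hWpos.ne' this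
  have ha1 : a * star a = 1 := mul_star_eq_one_of_re hna
  have ha1' : star a * a = 1 := by rw [star_comm_self', ha1]
  -- `a x̂ = F' a` with `F' = F x` or `−F x`
  have step : ∀ Y : ℍ[ℚ,((-1 : ℤ) : ℚ),((3 : ℤ) : ℚ)], v * W * ⟨0, x.1.1, x.1.2.1, x.1.2.2⟩ = Y * (v * W) →
      (Y * W = W * F x ∨ Y * W = W * (-F x)) →
      ∃ G : ℍ[ℚ,((-1 : ℤ) : ℚ),((3 : ℤ) : ℚ)], (G = F x ∨ G = -F x) ∧ star a * G = ⟨0, x.1.1, x.1.2.1, x.1.2.2⟩ * star a := by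
    intro Y hY hYW
    have hG : ∃ G : ℍ[ℚ,((-1 : ℤ) : ℚ),((3 : ℤ) : ℚ)], (G = F x ∨ G = -F x) ∧ Y * W = W * G := by
      rcases hYW with hYW | hYW
      · exact ⟨F x, Or.inl rfl, hYW⟩
      · exact ⟨-F x, Or.inr rfl, hYW⟩
    obtain ⟨G, hGF, hYW'⟩ := hG
    refine ⟨G, hGF, ?_⟩
    have haX : a * ⟨0, x.1.1, x.1.2.1, x.1.2.2⟩ = G * a := by
      apply hWu.mul_left_cancel
      calc W * (a * ⟨0, x.1.1, x.1.2.1, x.1.2.2⟩) = v * W * ⟨0, x.1.1, x.1.2.1, x.1.2.2⟩ := by rw [← mul_assoc, ← e]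
        _ = W * (G * a) := by rw [hY, e, ← mul_assoc, hYW', mul_assoc]
    calc star a * G = star a * G * (a * star a) := by rw [ha1, mul_one]
      _ = star a * (G * a) * star a := by simp only [mul_assoc]
      _ = star a * (a * ⟨0, x.1.1, x.1.2.1, x.1.2.2⟩) * star a := by rw [haX]
      _ = ⟨0, x.1.1, x.1.2.1, x.1.2.2⟩ * star a := by rw [← mul_assoc, ha1', one_mul]
  have hu : star a ∈ order (-1) 3 ∨ star a - ⟨1/2, 1/2, 1/2, -1/2⟩ ∈ order (-1) 3 := star_maxOrder ha
  have hun : (star a * star (star a)).re = 1 := by rw [star_star, ha1', QuaternionAlgebra.re_one]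
  rcases hc with hc | hc
  · obtain ⟨G, hGF, hG⟩ := step _ hc (Or.inl (hid x))
    rcases hGF with rfl | rfl
    · exact ⟨star a, hu, hun, Or.inl hG⟩
    · refine ⟨star a, hu, hun, Or.inr ?_⟩
      rw [mul_neg] at hG
      rw [neg_mul, ← hG, neg_neg]
  · obtain ⟨G, hGF, hG⟩ := step _ hc (Or.inr (by rw [neg_mul, hid x, mul_neg]))
    rcases hGF with rfl | rfl
    · exact ⟨star a, hu, hun, Or.inl hG⟩
    · refine ⟨star a, hu, hun, Or.inr ?_⟩
      rw [mul_neg] at hG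
      rw [neg_mul, ← hG, neg_neg]

end Engine

/-! ## §2 `ω₂`, `ω₃`, `ω₆` move every point of `Z(t)` on `X₆` -/

section Moves

/-- **`ω₂` FIXES NO POINT OF `Z(t)` ON `X₆`, `t ≡ 3 (mod 4)`**: for `x ∈ L(t)`, `t > 0`, `τ ∈ ℌ` with `ρ(x̂)τ = τ` and any
`v ∈ Γ₆`, `ρ(v)(ρ(w₂)τ) ≠ τ` — the point `ω₂·pr(z_x)` of `X₆` differs from `pr(z_x)` (the `P₂`-type of `Ad(w₂⁻¹)x̂`
differs from that of `±x̂` up to the norm-sign dichotomy: `atkinLehnerTwo_not_conj_self_or_neg`). [cite: KudlaRapoportYang2006, §3.4 Remark 3.4.7 and (3.4.11)] [cite: Ogg1983RealPoints, §2 p. 284] -/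
theorem atkinLehnerTwo_moves_specialPoints {t : ℤ} (ht : 0 < t) (h4 : t % 4 = 3)
    (x : {x : ℤ × ℤ × ℤ // x.1 ^ 2 - 3 * x.2.1 ^ 2 - 3 * x.2.2 ^ 2 = t}) {τ : ℂ} (hτ : 0 < τ.im)
    (hx : moebius (rho (-1) 3 (by norm_num) (castQ (-1) 3 (⟨0, x.1.1, x.1.2.1, x.1.2.2⟩ : ℍ[ℚ,((-1 : ℤ) : ℚ),((3 : ℤ) : ℚ)]))) τ = τ)
    {v : ℍ[ℚ,((-1 : ℤ) : ℚ),((3 : ℤ) : ℚ)]} (hv : v ∈ order (-1) 3 ∨ v - ⟨1/2, 1/2, 1/2, -1/2⟩ ∈ order (-1) 3) (hv1 : v * star v = 1) :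
    moebius (rho (-1) 3 (by norm_num) (castQ (-1) 3 v))
      (moebius (rho (-1) 3 (by norm_num) (castQ (-1) 3 (⟨1, 1, 0, 0⟩ : ℍ[ℚ,((-1 : ℤ) : ℚ),((3 : ℤ) : ℚ)]))) τ) ≠ τ := by
  intro h
  have h1O : ((1 : ℍ[ℚ,((-1 : ℤ) : ℚ),((3 : ℤ) : ℚ)]) ∈ order (-1) 3 ∨ (1 : ℍ[ℚ,((-1 : ℤ) : ℚ),((3 : ℤ) : ℚ)]) - ⟨1/2, 1/2, 1/2, -1/2⟩ ∈ order (-1) 3) := Or.inl (Subring.one_mem _)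
  have h11 : (1 : ℍ[ℚ,((-1 : ℤ) : ℚ),((3 : ℤ) : ℚ)]) * star 1 = 1 ∨ (1 : ℍ[ℚ,((-1 : ℤ) : ℚ),((3 : ℤ) : ℚ)]) * star 1 = -1 := Or.inl (by rw [star_one, mul_one])
  have hRt := (normalises_of_eq_smul_unit_mul_atkinLehner (g := ⟨1, 1, 0, 0⟩) (q := 1) h1O h11 1 0
    (by rw [pow_one, pow_zero, mul_one, one_mul, one_smul])).2.2
  have hU : IsUnit (⟨1, 1, 0, 0⟩ : ℍ[ℚ,((-1 : ℤ) : ℚ),((3 : ℤ) : ℚ)]) :=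
    ⟨⟨⟨1, 1, 0, 0⟩, ⟨1/2, -1/2, 0, 0⟩, by rw [QuaternionAlgebra.mk_mul_mk]; ext <;> norm_num,
      by rw [QuaternionAlgebra.mk_mul_mk]; ext <;> norm_num⟩, rfl⟩
  have hn : ((⟨1, 1, 0, 0⟩ : ℍ[ℚ,((-1 : ℤ) : ℚ),((3 : ℤ) : ℚ)]) * star ⟨1, 1, 0, 0⟩).re = 2 := by
    rw [QuaternionAlgebra.star_mk, QuaternionAlgebra.mk_mul_mk]; norm_num
  obtain ⟨u, hu, hun, hc⟩ := exists_unit_conj_of_atkinLehner_fixes ht hn two_pos hU hRt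
    (F := fun z ↦ ⟨0, ((z.1.1 : ℤ) : ℚ), ((z.1.2.2 : ℤ) : ℚ), ((-z.1.2.1 : ℤ) : ℚ)⟩)
    (fun z ↦ pureVec_mul_one_add_i _ _ _) x hτ hx hv hv1 h
  have hq : 0 < x.1.1 ^ 2 - 3 * x.1.2.1 ^ 2 - 3 * x.1.2.2 ^ 2 := by
    have hx2 : x.1.1 ^ 2 - 3 * x.1.2.1 ^ 2 - 3 * x.1.2.2 ^ 2 = t := x.2
    rw [hx2]; exact ht
  have hodd : Odd x.1.1 ∧ Odd x.1.2.1 ∧ Odd x.1.2.2 := by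
    have hx2 : x.1.1 ^ 2 - 3 * x.1.2.1 ^ 2 - 3 * x.1.2.2 ^ 2 = t := x.2
    have h' := (odd_iff_norm_emod_four ![x.1.1, x.1.2.1, x.1.2.2]).2
    simp only [Matrix.cons_val_zero, Matrix.cons_val_one, Matrix.cons_val_two, Matrix.head_cons, Matrix.tail_cons] at h'
    exact h' (by rw [hx2]; exact h4)
  obtain ⟨hx₁, hx₂, hx₃⟩ := hodd
  have key := atkinLehnerTwo_not_conj_self_or_neg hq hx₁ hx₂ hx₃ hu hun
  rcases hc with hc | hc
  · exact key.1 hc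
  · exact key.2 hc

/-- **`ω₃` FIXES NO POINT OF `Z(t)` ON `X₆`, `3 ∤ t`**: for `x ∈ L(t)`, `t > 0`, `τ ∈ ℌ` with `ρ(x̂)τ = τ` and any `v ∈ Γ₆`,
`ρ(v)(ρ(μ)τ) ≠ τ` (`P₃`-types: `atkinLehnerThree_not_conj_self_or_neg`). [cite: KudlaRapoportYang2006, §3.4 Remark 3.4.7 and (3.4.11)] [cite: Ogg1983RealPoints, §2 p. 284] -/
theorem atkinLehnerThree_moves_specialPoints {t : ℤ} (ht : 0 < t) (h3 : ¬ (3 : ℤ) ∣ t)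
    (x : {x : ℤ × ℤ × ℤ // x.1 ^ 2 - 3 * x.2.1 ^ 2 - 3 * x.2.2 ^ 2 = t}) {τ : ℂ} (hτ : 0 < τ.im)
    (hx : moebius (rho (-1) 3 (by norm_num) (castQ (-1) 3 (⟨0, x.1.1, x.1.2.1, x.1.2.2⟩ : ℍ[ℚ,((-1 : ℤ) : ℚ),((3 : ℤ) : ℚ)]))) τ = τ)
    {v : ℍ[ℚ,((-1 : ℤ) : ℚ),((3 : ℤ) : ℚ)]} (hv : v ∈ order (-1) 3 ∨ v - ⟨1/2, 1/2, 1/2, -1/2⟩ ∈ order (-1) 3) (hv1 : v * star v = 1) :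
    moebius (rho (-1) 3 (by norm_num) (castQ (-1) 3 v))
      (moebius (rho (-1) 3 (by norm_num) (castQ (-1) 3 (⟨3, 0, 1, 1⟩ : ℍ[ℚ,((-1 : ℤ) : ℚ),((3 : ℤ) : ℚ)]))) τ) ≠ τ := by
  intro h
  have h1O : ((1 : ℍ[ℚ,((-1 : ℤ) : ℚ),((3 : ℤ) : ℚ)]) ∈ order (-1) 3 ∨ (1 : ℍ[ℚ,((-1 : ℤ) : ℚ),((3 : ℤ) : ℚ)]) - ⟨1/2, 1/2, 1/2, -1/2⟩ ∈ order (-1) 3) := Or.inl (Subring.one_mem _)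
  have h11 : (1 : ℍ[ℚ,((-1 : ℤ) : ℚ),((3 : ℤ) : ℚ)]) * star 1 = 1 ∨ (1 : ℍ[ℚ,((-1 : ℤ) : ℚ),((3 : ℤ) : ℚ)]) * star 1 = -1 := Or.inl (by rw [star_one, mul_one])
  have hRt := (normalises_of_eq_smul_unit_mul_atkinLehner (g := ⟨3, 0, 1, 1⟩) (q := 1) h1O h11 0 1
    (by rw [pow_zero, pow_one, one_mul, one_mul, one_smul])).2.2
  have hU : IsUnit (⟨3, 0, 1, 1⟩ : ℍ[ℚ,((-1 : ℤ) : ℚ),((3 : ℤ) : ℚ)]) :=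
    ⟨⟨⟨3, 0, 1, 1⟩, ⟨1, 0, -1/3, -1/3⟩, by rw [QuaternionAlgebra.mk_mul_mk]; ext <;> norm_num,
      by rw [QuaternionAlgebra.mk_mul_mk]; ext <;> norm_num⟩, rfl⟩
  have hn : ((⟨3, 0, 1, 1⟩ : ℍ[ℚ,((-1 : ℤ) : ℚ),((3 : ℤ) : ℚ)]) * star ⟨3, 0, 1, 1⟩).re = 3 := by
    rw [QuaternionAlgebra.star_mk, QuaternionAlgebra.mk_mul_mk]; norm_num
  obtain ⟨u, hu, hun, hc⟩ := exists_unit_conj_of_atkinLehner_fixes ht hn three_pos hU hRt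
    (F := fun z ↦ ⟨0, ((5 * z.1.1 - 6 * z.1.2.1 + 6 * z.1.2.2 : ℤ) : ℚ), ((-2 * z.1.1 + 3 * z.1.2.1 - 2 * z.1.2.2 : ℤ) : ℚ),
      ((2 * z.1.1 - 2 * z.1.2.1 + 3 * z.1.2.2 : ℤ) : ℚ)⟩)
    (fun z ↦ pureVec_mul_mu _ _ _) x hτ hx hv hv1 h
  have hq : 0 < x.1.1 ^ 2 - 3 * x.1.2.1 ^ 2 - 3 * x.1.2.2 ^ 2 := by
    have hx2 : x.1.1 ^ 2 - 3 * x.1.2.1 ^ 2 - 3 * x.1.2.2 ^ 2 = t := x.2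
    rw [hx2]; exact ht
  have hx3 : ¬ (3 : ℤ) ∣ x.1.1 := fun d ↦ by
    have hx2 : x.1.1 ^ 2 - 3 * x.1.2.1 ^ 2 - 3 * x.1.2.2 ^ 2 = t := x.2
    exact h3 (hx2 ▸ (three_dvd_specialNorm_iff _ _ _).2 d)
  have key := atkinLehnerThree_not_conj_self_or_neg hq hx3 hu hun
  rcases hc with hc | hc
  · exact key.1 hc
  · exact key.2 hc

/-- **`ω₆` FIXES NO POINT OF `Z(t)` ON `X₆`, `3 ∤ t`**: for `x ∈ L(t)`, `t > 0`, `τ ∈ ℌ` with `ρ(x̂)τ = τ` and any `v ∈ Γ₆`,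
`ρ(v)(ρ(w₆)τ) ≠ τ`, `w₆ = 3 + 3i + 2ij` (types + the norm-sign dichotomy: `atkinLehnerSix_not_conj_self_or_neg`). Hence
for `t ≡ 19 (mod 24)` the whole Atkin–Lehner group `W ≅ (ℤ/2ℤ)²` acts freely on the points of `Z(t)` on `X₆`.
[cite: KudlaRapoportYang2006, §3.4 Remark 3.4.7 and (3.4.11)] [cite: Ogg1983RealPoints, §2 p. 284 («In general, `ε = −1` so `μ² = −m`»)] [cite: BayerTravesa2007, §2] -/
theorem atkinLehnerSix_moves_specialPoints {t : ℤ} (ht : 0 < t) (h3 : ¬ (3 : ℤ) ∣ t)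
    (x : {x : ℤ × ℤ × ℤ // x.1 ^ 2 - 3 * x.2.1 ^ 2 - 3 * x.2.2 ^ 2 = t}) {τ : ℂ} (hτ : 0 < τ.im)
    (hx : moebius (rho (-1) 3 (by norm_num) (castQ (-1) 3 (⟨0, x.1.1, x.1.2.1, x.1.2.2⟩ : ℍ[ℚ,((-1 : ℤ) : ℚ),((3 : ℤ) : ℚ)]))) τ = τ)
    {v : ℍ[ℚ,((-1 : ℤ) : ℚ),((3 : ℤ) : ℚ)]} (hv : v ∈ order (-1) 3 ∨ v - ⟨1/2, 1/2, 1/2, -1/2⟩ ∈ order (-1) 3) (hv1 : v * star v = 1) :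
    moebius (rho (-1) 3 (by norm_num) (castQ (-1) 3 v))
      (moebius (rho (-1) 3 (by norm_num) (castQ (-1) 3 (⟨3, 3, 0, 2⟩ : ℍ[ℚ,((-1 : ℤ) : ℚ),((3 : ℤ) : ℚ)]))) τ) ≠ τ := by
  intro h
  have h1O : ((1 : ℍ[ℚ,((-1 : ℤ) : ℚ),((3 : ℤ) : ℚ)]) ∈ order (-1) 3 ∨ (1 : ℍ[ℚ,((-1 : ℤ) : ℚ),((3 : ℤ) : ℚ)]) - ⟨1/2, 1/2, 1/2, -1/2⟩ ∈ order (-1) 3) := Or.inl (Subring.one_mem _)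
  have h11 : (1 : ℍ[ℚ,((-1 : ℤ) : ℚ),((3 : ℤ) : ℚ)]) * star 1 = 1 ∨ (1 : ℍ[ℚ,((-1 : ℤ) : ℚ),((3 : ℤ) : ℚ)]) * star 1 = -1 := Or.inl (by rw [star_one, mul_one])
  have hw6 : (⟨1, 1, 0, 0⟩ : ℍ[ℚ,((-1 : ℤ) : ℚ),((3 : ℤ) : ℚ)]) * ⟨3, 0, 1, 1⟩ = ⟨3, 3, 0, 2⟩ := (pureVec_mul_w6 0 0 0).1
  have hRt := (normalises_of_eq_smul_unit_mul_atkinLehner (g := ⟨3, 3, 0, 2⟩) (q := 1) h1O h11 1 1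
    (by rw [pow_one, pow_one, one_mul, one_smul, hw6])).2.2
  have hU : IsUnit (⟨3, 3, 0, 2⟩ : ℍ[ℚ,((-1 : ℤ) : ℚ),((3 : ℤ) : ℚ)]) :=
    ⟨⟨⟨3, 3, 0, 2⟩, ⟨1/2, -1/2, 0, -1/3⟩, by rw [QuaternionAlgebra.mk_mul_mk]; ext <;> norm_num,
      by rw [QuaternionAlgebra.mk_mul_mk]; ext <;> norm_num⟩, rfl⟩
  have hn : ((⟨3, 3, 0, 2⟩ : ℍ[ℚ,((-1 : ℤ) : ℚ),((3 : ℤ) : ℚ)]) * star ⟨3, 3, 0, 2⟩).re = 6 := by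
    rw [QuaternionAlgebra.star_mk, QuaternionAlgebra.mk_mul_mk]; norm_num
  obtain ⟨u, hu, hun, hc⟩ := exists_unit_conj_of_atkinLehner_fixes ht hn (by norm_num) hU hRt
    (F := fun z ↦ ⟨0, ((5 * z.1.1 - 6 * z.1.2.1 - 6 * z.1.2.2 : ℤ) : ℚ), ((-2 * z.1.1 + 2 * z.1.2.1 + 3 * z.1.2.2 : ℤ) : ℚ),
      ((2 * z.1.1 - 3 * z.1.2.1 - 2 * z.1.2.2 : ℤ) : ℚ)⟩)
    (fun z ↦ (pureVec_mul_w6 _ _ _).2) x hτ hx hv hv1 h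
  have hq : 0 < x.1.1 ^ 2 - 3 * x.1.2.1 ^ 2 - 3 * x.1.2.2 ^ 2 := by
    have hx2 : x.1.1 ^ 2 - 3 * x.1.2.1 ^ 2 - 3 * x.1.2.2 ^ 2 = t := x.2
    rw [hx2]; exact ht
  have hx3 : ¬ (3 : ℤ) ∣ x.1.1 := fun d ↦ by
    have hx2 : x.1.1 ^ 2 - 3 * x.1.2.1 ^ 2 - 3 * x.1.2.2 ^ 2 = t := x.2
    exact h3 (hx2 ▸ (three_dvd_specialNorm_iff _ _ _).2 d)
  have key := atkinLehnerSix_not_conj_self_or_neg hq (Or.inl hx3) hu hun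
  rcases hc with hc | hc
  · exact key.1 hc
  · exact key.2 hc

end Moves

end Literature.Geometry.Kaehler.ComplexTorus.QuaternionType
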